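import Literature.MathematicalPhysics.QuantumFieldTheory.Balaban1983to89.T4ShellMeasureFibre
import Literature.MathematicalPhysics.QuantumFieldTheory.Balaban1983to89.B14FlowStep

/-!
# N21 (NE7c) · AGE BOOKKEEPING on the live window for the dilation road's constants (lens Card 77 ∕ ROW W)

R134 seat pub-ymgap-dag-n21-d (g8), node N21 = NE7c (single-run shell-weight bound, NOT PRINTED in [Bałaban 1983–89],
NOT proved), lane K3⁷ `SpineGivenEndpointR13SepCoPH` (stmt-QuantumFields-20544, `--kind proof --supports … --as helper`).
Part 25 of the comparison series.  THIS FILE = LENS ROW W of `LENS-nearmiss.md` v26.0: §C of the lens's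
`Sketch-nearmiss-g26.lean` VERBATIM — statements and proofs — re-homed in this namespace.  AUTHORSHIP OF THE
MATHEMATICS: planner seat `ym-lens-BalabanUVNodes-nearmiss` g26; this seat only files.

WHAT (lens Card 77).  Coupling-borne level constants are functions of the AGE `K − j`; on
`T4ShellMeasureLevels.LiveWindow` (`K ≤ j + N₁`) they are bounded by K-independent numbers ([III] = Bałaban CMP 119
(1988) (2.9), tree `B14FlowStep.FlowIneq29` BY NAME) — so part 17's `hd` (polynomial block dimension) is met with
`p = 0`: the header words of parts 16–17 should read «bounded on the live window by (2.9) from the renormalised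
coupling», not «polynomial in j» (lens census nnnnnnnn — agreed).

HONEST FRAMING.  [folklore] arithmetic; 0 def, 0 sorry; nothing of Bałaban's asserted; NE7c NOT PRINTED ∕ NOT proved;
N21 NOT discharged; counts unmoved (typed 28∕28 · discharged 5∕27); count-neutral; one finite 𝕋⁴ at fixed ε —
nothing about ℝ⁴ ∕ OS ∕ mass gap ∕ Clay.
-/

open MeasureTheory Set
open scoped ENNReal
open Literature.MathematicalPhysics.QuantumFieldTheory.Balaban1983to89
open Literature.MathematicalPhysics.QuantumFieldTheory.Balaban1983to89.T4ShellMeasure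

namespace Summit.QuantumFields.YangMills.Theorems.N21DilationAgeWindow

/-! ## §C  Age bookkeeping on the live window (Card 77) -/

/-- A level constant bounded by a MONOTONE function of the age `K − j` is bounded, on the live window `K ≤ j + N₁`,
by the `K`-independent number `f N₁`. [folklore] -/
theorem const_le_on_window {f : ℕ → ℝ} (hf : Monotone f) {K j N₁ : ℕ} (hK : K ≤ j + N₁) {D : ℝ}
    (hD : D ≤ f (K - j)) : D ≤ f N₁ :=
  hD.trans (hf (by omega))

/-- The (2.8)∕(2.9) third-member factor on the window: `(1 + β₀)²(K − j)^{β₀} ≤ (1 + β₀)² N₁^{β₀}`.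
[cite: Balaban1988Convergent, (2.8)–(2.9) p.256] -/
theorem flow_factor_le_on_window {β₀ : ℝ} (hβ₀ : 0 ≤ β₀) {K j N₁ : ℕ} (hjK : j ≤ K) (hK : K ≤ j + N₁) :
    (1 + β₀) ^ 2 * ((K : ℝ) - j) ^ β₀ ≤ (1 + β₀) ^ 2 * (N₁ : ℝ) ^ β₀ := by
  have h0 : 0 ≤ (K : ℝ) - j := by rw [sub_nonneg]; exact_mod_cast hjK
  have h1 : (K : ℝ) - j ≤ N₁ := by
    have : (K : ℝ) ≤ (j : ℝ) + N₁ := by exact_mod_cast hK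
    linarith
  exact mul_le_mul_of_nonneg_left (Real.rpow_le_rpow h0 h1 hβ₀) (by positivity)

/-- **REACH PROFILE ON THE WINDOW** from the typed (2.9) (`B14FlowStep.FlowIneq29`, second member): for `j < K`,
`K ≤ j + N₁`, `R_j ≤ L (1 + g_K² β′ N₁)^{β₀} R_K` — a number fixed by `(L, β′, β₀, N₁)` and the RENORMALISED data
`(g_K, R_K)`, independent of `K`; so block dimensions `d_j = (LM₂R_j)⁴` and every `p(g_j)`-borne level constant of
the dilation road (G16 `D = Q(d)∕(aθ)`, G21 `Λ`) are `K`-uniform on `T4ShellMeasureLevels.LiveWindow` — NOT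
"polynomial in j": they are functions of the age. [cite: Balaban1988Convergent, (2.9) p.256] -/
theorem reach_le_on_window {R : ℕ → ℕ} {g : ℕ → ℝ} {L : ℕ} {β' β₀ : ℝ} {K : ℕ}
    (h29 : B14FlowStep.FlowIneq29 R g L β' β₀ K) (hβ' : 0 ≤ β') (hβ₀ : 0 ≤ β₀)
    {j N₁ : ℕ} (hjK : j < K) (hK : K ≤ j + N₁) :
    (R j : ℝ) ≤ L * (1 + (g K) ^ 2 * β' * N₁) ^ β₀ * R K := by
  obtain ⟨_, h2⟩ := h29 j K hjK le_rfl
  have hx : 0 ≤ (g K) ^ 2 * β' := by positivity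
  have hKj : (K : ℝ) - j ≤ N₁ := by
    have : (K : ℝ) ≤ (j : ℝ) + N₁ := by exact_mod_cast hK
    linarith
  have hKj0 : 0 ≤ (K : ℝ) - j := by rw [sub_nonneg]; exact_mod_cast hjK.le
  have hbase : 0 ≤ 1 + (g K) ^ 2 * β' * ((K : ℝ) - j) := by
    have := mul_nonneg hx hKj0; linarith
  have hmono : 1 + (g K) ^ 2 * β' * ((K : ℝ) - j) ≤ 1 + (g K) ^ 2 * β' * N₁ := by
    have := mul_le_mul_of_nonneg_left hKj hx; linarith
  have h1 : (1 + (g K) ^ 2 * β' * ((K : ℝ) - j)) ^ β₀ ≤ (1 + (g K) ^ 2 * β' * N₁) ^ β₀ :=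
    Real.rpow_le_rpow hbase hmono hβ₀
  calc (R j : ℝ) ≤ L * (1 + (g K) ^ 2 * β' * ((K : ℝ) - j)) ^ β₀ * R K := h2
    _ ≤ L * (1 + (g K) ^ 2 * β' * N₁) ^ β₀ * R K := by
        have hL : (0 : ℝ) ≤ L := by positivity
        have hR : (0 : ℝ) ≤ R K := by positivity
        exact mul_le_mul_of_nonneg_right (mul_le_mul_of_nonneg_left h1 hL) hR

/-- **LEDGER FORM**: an (M1) level constant `D K j ≤ f(K − j)` with `f` monotone becomes the `K`-INDEPENDENT
constant `f N₁` on the live window (`T4ShellMeasureFibre.slotAntiConcentration_mono`). [folklore] -/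
theorem slotAntiConcentration_uniform_on_window {Ω : Type*} [MeasurableSpace Ω] {μ : Measure Ω}
    {u : Ω → ℝ} {θ ρ : ℝ} (hρ : 0 ≤ ρ) {f : ℕ → ℝ} (hf : Monotone f) {D : ℕ → ℕ → ℝ} {K j N₁ : ℕ}
    (hK : K ≤ j + N₁) (hD : D K j ≤ f (K - j)) (h : SlotAntiConcentration μ u θ ρ (D K j)) :
    SlotAntiConcentration μ u θ ρ (f N₁) :=
  T4ShellMeasureFibre.slotAntiConcentration_mono hρ (const_le_on_window hf hK hD) h

end Summit.QuantumFields.YangMills.Theorems.N21DilationAgeWindow
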